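import Literature.MathematicalPhysics.QuantumFieldTheory.Balaban1983to89.Node00.ContinuousTransportOnDomainOfRecord

/-!
# NODE 00 · def-T (g6) — THE β-COMPARISON LEMMA: β over the on-domain transport `TcOnOfRecord` vs β over the everywhere transport `TcOfRecord`

`pub-ymgap-node00-def-T` (DEFINER lineage def-T = the continuous-version transport `TcOfRecord` and the β read through it, FILE 4
`Node00.ContinuousTransportOfRecord`), generation g6.  APPEND-ONLY: a NEW importing module over K0e's `Node00.ContinuousTransportOnDomainOfRecord`
(the on-domain transport `TcOnOfRecord ν` and `betaOfRecord₈cOn ∕ betaOfRecord₉cOn`); nothing landed is edited.  Answers the located ask NODEO-P3 (C196):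
*the one event that breaks the ₁₀ ⇒ successor transport of the flow-keyed supplies is a β re-base; it transports again through ONE β-comparison lemma
under ₁₀'s everywhere proviso `contT` (+ `0 < ε₀`)*.

## What is proved (kernel bookkeeping + locality of the Fréchet derivative; nothing of Bałaban's asserted)

* §1 LOCALITY OF (1.20): the polarisation tensor `polTensor 𝕜 𝓔 = D²𝓔(0)(δ·, δ·)` reads only the GERM of `𝓔` at `B = 0`
  (`polTensor_congr_of_eventuallyEq`, via Mathlib's `Filter.EventuallyEq.fderiv_eq`); hence `polScalar ∕ polWindow` agree for functionals whose charts
  agree near `0`, `polLimit` agrees for window families agreeing eventually in `K` (`limUnder` of eventually equal sequences), and `betaMerged ∕ beta0OfMerged ∕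
  betaOfMerged` agree LEVEL BY LEVEL (`…_congr_at`).
* §2 THE CHART READ AS A FIELD: `chartField ρ K j B := readField (suOfMat N) (exp ρB)` is CONTINUOUS AT `B = 0` with value the unit configuration
  (`suOfMat` is continuous at `1`: it is the identity on `SU(N)` and `1` elsewhere), so `B ↦ chartField B` is EVENTUALLY (near `0`) inside every open set
  containing `1` — in particular inside the record's small-field domains `domAltOfRecord ν K j` when `0 < ε₀` (n09-a's `isOpen_domAltOfRecord`, K0e's
  `one_mem_domAltOfRecord`).
* §3 LEVEL 0 IS FREE: under `0 < ε₀` and the record's everywhere proviso `HasContTransportAlong` (`Provisos₁₀.contT`), `betaOfRecord₈cOn θ 0 = betaOfRecord₈c θ 0`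
  (`A_0 = −A/g_0²` reads no transport; `A_1^{On} = A_1^{c}` on `domAltOfRecord ν K 1` by K0e's `effActionHT_TcOnOfRecord_eqOn`, a neighbourhood of the
  chart's base point) — so the first renormalised coupling `g_1` of every run agrees (`genSeq_betaOfRecord₉cOn_eq_of_le_one`).
* §4 ALL LEVELS UNDER ONE LOCATED HYPOTHESIS: the merged term (1.6) at level `k ≥ 1` also reads `A_k(Ū^k(U_{k+1}(W)))`; the two `A_k` agree ON `domAltOfRecord ν K k`
  only, so the comparison at level `k` needs the averaged background of a near-unit `W` to lie in the level-`k` domain — print's nesting of small-field domains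
  under the background map ([I] p. 259–260: *«this condition implies |V(∂p′) − 1| < 2ε₀ … Proposition 2 [12] … Theorem 1 [15]»*), a regularity ESTIMATE of
  [Balaban1985Averaging] Prop. 2 ∕ [Balaban1985Variational] Thm 1, typed here as the NAMED HYPOTHESIS `Stage8Params.AvgBgNest` (never asserted).  Under it:
  `betaOfRecord₈cOn θ = betaOfRecord₈c θ`, `betaOfRecord₉cOn θ = betaOfRecord₉c θ = betaOfRecord₁₀ θ`, hence `genFlow ∕ genSeq ∕ gOfRecord₁₀` agree run by run
  (`genFlow_betaOfRecord₉cOn_eq`, `gOfRecord₁₀_eq_genSeq_betaOfRecord₉cOn`) — the (C196) lemma, with its exact price displayed.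

HONEST: definitions of record and kernel bookkeeping; `AvgBgNest` and `HasContTransportAlong` are HYPOTHESES wherever used; no estimate of [12]∕[15] is proved;
counts unmoved; one finite-torus programme at fixed ε, nothing continuum ∕ OS ∕ mass-gap ∕ Clay.  No `sorry`, no `instance`, no `notation`.
-/

namespace Literature.MathematicalPhysics.QuantumFieldTheory.Balaban1983to89.Node00

open Filter Set
open _root_.Topology
open scoped Matrix.Norms.L2Operator
open NormedSpace (exp)
open T4Continuum (T4Family)
open FlowStep (HBeta prefixOf)
open FlowStepRuns (genSeq genFlow)
open T4FlagMemory (extd)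
open B12PolarizationTensor120 (polTensor polTensor_def polComp expChart)
open B12ContinuousTransportInvarianceOn (isOpen_domAltOfRecord)

/-! ## §1. Locality of the polarisation kernel (1.20): only the germ of the functional at `B = 0` is read -/

section Locality

variable (𝕜 : Type*) [NontriviallyNormedField 𝕜] {Λ T V E : Type*} [Fintype Λ] [Fintype T] [DecidableEq Λ]
  [DecidableEq T] [NormedAddCommGroup V] [NormedSpace 𝕜 V] [NormedAddCommGroup E] [NormedSpace 𝕜 E]

omit [Fintype Λ] [Fintype T] in
/-- **(1.20) is LOCAL at `B = 0`**: two functionals agreeing on a neighbourhood of `0` have the same vacuum-polarisation tensor (the second Fréchet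
derivative at `0` reads only the germ: `Filter.EventuallyEq.fderiv_eq`, twice). [cite: Balaban1987RG1, (1.20) p.264 (bookkeeping)] -/
theorem polTensor_congr_of_eventuallyEq {𝓔₁ 𝓔₂ : (Λ → T → V) → E} (h : 𝓔₁ =ᶠ[𝓝 0] 𝓔₂) : polTensor 𝕜 𝓔₁ = polTensor 𝕜 𝓔₂ := by
  funext μ x v ν y w
  rw [polTensor_def, polTensor_def, (h.fderiv (𝕜 := 𝕜)).fderiv_eq]

omit [Fintype Λ] [Fintype T] in
/-- … hence the same components `Π^{ab}` in any basis. [cite: Balaban1987RG1, (1.20) p.264 (bookkeeping)] -/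
theorem polComp_congr_of_eventuallyEq {ι : Type*} {𝓔₁ 𝓔₂ : (Λ → T → V) → E} (h : 𝓔₁ =ᶠ[𝓝 0] 𝓔₂) (bV : Module.Basis ι 𝕜 V) :
    polComp 𝕜 𝓔₁ bV = polComp 𝕜 𝓔₂ bV := by
  funext μ x a ν y b
  unfold polComp
  rw [polTensor_congr_of_eventuallyEq 𝕜 h]

end Locality

section BetaLocality

variable {𝔄 : Type*} [NormedRing 𝔄] [NormedAlgebra ℝ 𝔄]
variable {V : Type*} [NormedAddCommGroup V] [NormedSpace ℝ V] {ι : Type*} [Fintype ι]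

/-- The scalar kernel (1.21)₁ of two term functionals whose charts `B ↦ ℰ(exp ρB)` agree near `B = 0` coincide. [cite: Balaban1987RG1, (1.20)–(1.21) p.264 (bookkeeping)] -/
theorem polScalar_congr_of_eventuallyEq {Λ T : Type*} [Fintype Λ] [Fintype T] [DecidableEq Λ] [DecidableEq T] {ℰ₁ ℰ₂ : (Λ → T → 𝔄) → ℝ}
    (ρ : V →L[ℝ] 𝔄) (bV : Module.Basis ι ℝ V) (h : expChart ℰ₁ ρ =ᶠ[𝓝 0] expChart ℰ₂ ρ) : polScalar ℰ₁ ρ bV = polScalar ℰ₂ ρ bV := by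
  funext μ x ν y
  unfold polScalar
  rw [polComp_congr_of_eventuallyEq ℝ h bV]

/-- … hence the windowed finite-volume kernels (1.21) coincide. [cite: Balaban1987RG1, (1.21) p.264 (bookkeeping)] -/
theorem polWindow_congr_of_eventuallyEq (F : T4Family) (K j : ℕ) {ℰ₁ ℰ₂ : (Fin (F.P K).d → Site (F.P K) j → 𝔄) → ℝ} (ρ : V →L[ℝ] 𝔄)
    (bV : Module.Basis ι ℝ V) (h : expChart ℰ₁ ρ =ᶠ[𝓝 0] expChart ℰ₂ ρ) : polWindow F K j ℰ₁ ρ bV = polWindow F K j ℰ₂ ρ bV := by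
  funext μ ν z
  unfold polWindow
  rw [polScalar_congr_of_eventuallyEq ρ bV h]

/-- **The `K → ∞` kernel (1.21) reads only the tail of the window family**: families of windowed kernels agreeing for all large `K` have the same `polLimit`
(`limUnder` along `atTop` of eventually equal sequences). [cite: Balaban1987RG1, (1.21) p.264 (bookkeeping)] -/
theorem polLimit_congr_of_eventually (F : T4Family) (j : ℕ) {ℰ₁ ℰ₂ : (K : ℕ) → (Fin (F.P K).d → Site (F.P K) j → 𝔄) → ℝ} (ρ : V →L[ℝ] 𝔄)
    (bV : Module.Basis ι ℝ V) (h : ∀ᶠ K in atTop, polWindow F K j (ℰ₁ K) ρ bV = polWindow F K j (ℰ₂ K) ρ bV) :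
    polLimit F j ℰ₁ ρ bV = polLimit F j ℰ₂ ρ bV := by
  funext μ ν z
  have h' : (fun K => polWindow F K j (ℰ₁ K) ρ bV μ ν z) =ᶠ[atTop] fun K => polWindow F K j (ℰ₂ K) ρ bV μ ν z :=
    h.mono fun K hK => show polWindow F K j (ℰ₁ K) ρ bV μ ν z = polWindow F K j (ℰ₂ K) ρ bV μ ν z by rw [hK]
  unfold polLimit Filter.limUnder
  rw [Filter.map_congr h']

/-- **`β_merged` at level `k` reads only the germs at `B = 0` of the charts of `ℰ k hist K` for large `K`**. [cite: Balaban1987RG1, (1.22) p.264 and (1.6) p.261 (bookkeeping)] -/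
theorem betaMerged_congr_at (F : T4Family) {ℰ₁ ℰ₂ : TermFamily1 F 𝔄} (ρ : V →L[ℝ] 𝔄) (bV : Module.Basis ι ℝ V) {k : ℕ}
    (h : ∀ hist : Fin (k + 1) → ℝ, ∀ᶠ K in atTop, expChart (ℰ₁ k hist K) ρ =ᶠ[𝓝 0] expChart (ℰ₂ k hist K) ρ) :
    betaMerged F ℰ₁ ρ bV k = betaMerged F ℰ₂ ρ bV k := by
  funext hist
  unfold betaMerged
  rw [polLimit_congr_of_eventually F (k + 1) ρ bV ((h hist).mono fun K hK => polWindow_congr_of_eventuallyEq F K (k + 1) ρ bV hK)]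

/-- The one-loop number at level `k` reads only `βm k`. [cite: Balaban1987RG1, (2.12)–(2.14) p.268 (bookkeeping)] -/
theorem beta0OfMerged_congr_at {βm₁ βm₂ : FlowStep.HBeta} (v₀ : (k : ℕ) → (Fin (k + 1) → ℝ)) {k : ℕ} (h : βm₁ k = βm₂ k) :
    beta0OfMerged βm₁ v₀ k = beta0OfMerged βm₂ v₀ k := by
  unfold beta0OfMerged
  rw [h]

/-- The β of record at level `k` reads only `βm k` and `β0 k`. [cite: Balaban1987RG1, (1.22) p.264 and (2.12)–(2.14) p.268 (bookkeeping)] -/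
theorem betaOfMerged_congr_at {βm₁ βm₂ : FlowStep.HBeta} {β0₁ β0₂ : ℕ → ℝ} (γ : ℝ) {k : ℕ} (h : βm₁ k = βm₂ k) (h0 : β0₁ k = β0₂ k) :
    betaOfMerged βm₁ β0₁ γ k = betaOfMerged βm₂ β0₂ γ k := by
  funext v
  unfold betaOfMerged
  rw [h, h0]

end BetaLocality

/-! ## §2. The chart `B ↦ (exp ρB_ν(x))` read as an `SU(N)` field: continuity at the base point `B = 0` -/

section Chart

variable (F : T4Family) (N : ℕ)

/-- Off `SU(N)` the retraction `suOfMat` (the read-back of print's chart `exp(iB)` to the group, p. 264) takes the value `1`.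
[cite: Balaban1987RG1, p.264 (before (1.20)) (bookkeeping)] -/
theorem suOfMat_of_not_mem {A : Matrix (Fin N) (Fin N) ℂ} (h : A ∉ Matrix.specialUnitaryGroup (Fin N) ℂ) : suOfMat N A = 1 := by
  unfold suOfMat
  rw [dif_neg h]

/-- The retraction at the unit matrix is the unit (the chart's base point `B = 0`). [cite: Balaban1987RG1, (1.20) p.264 (bookkeeping)] -/
theorem suOfMat_one : suOfMat N (1 : Matrix (Fin N) (Fin N) ℂ) = 1 :=
  suOfMat_coe (1 : SU N)

/-- **The retraction `suOfMat` is CONTINUOUS AT THE UNIT** (it is the identity on `SU(N)` and `1` off it: the preimage of a neighbourhood of `1` contains that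
neighbourhood) — the one topological fact the germ argument of (1.20) needs of the read-back. [cite: Balaban1987RG1, (1.20) p.264 (bookkeeping)] -/
theorem continuousAt_suOfMat_one : ContinuousAt (suOfMat N) (1 : Matrix (Fin N) (Fin N) ℂ) := by
  rw [Topology.IsInducing.subtypeVal.continuousAt_iff]
  show Tendsto (fun A => ((suOfMat N A : SU N) : Matrix (Fin N) (Fin N) ℂ)) (𝓝 1) (𝓝 ((suOfMat N 1 : SU N) : Matrix (Fin N) (Fin N) ℂ))
  rw [suOfMat_one]
  refine tendsto_def.2 fun s hs => mem_of_superset hs fun A hA => ?_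
  show ((suOfMat N A : SU N) : Matrix (Fin N) (Fin N) ℂ) ∈ s
  by_cases h : A ∈ Matrix.specialUnitaryGroup (Fin N) ℂ
  · rwa [suOfMat_of_mem h]
  · rw [suOfMat_of_not_mem N h]
    exact mem_of_mem_nhds hs

variable {V : Type*} [NormedAddCommGroup V] [NormedSpace ℝ V]

/-- **Print's chart read as a gauge field**: `B ↦ (suOfMat (exp ρB_ν(x)))_{⟨x, ν⟩}` — the `SU(N)` configuration at which the merged term (1.6) is evaluated when
its chart `expChart` (p. 264 before (1.20)) is differentiated; `ρ` = the β-layer's direction map `ρ8`. [cite: Balaban1987RG1, p.264 (before (1.20))] -/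
noncomputable def chartField (ρ : V →L[ℝ] Matrix (Fin N) (Fin N) ℂ) (K j : ℕ) (B : Fin (F.P K).d → Site (F.P K) j → V) : GaugeField (F.P K) j (SU N) :=
  readField F N (suOfMat N) (fun ν x => exp (ρ (B ν x)))

/-- Unfolding (`rfl`). [cite: Balaban1987RG1, p.264 (before (1.20)) (bookkeeping)] -/
theorem chartField_apply (ρ : V →L[ℝ] Matrix (Fin N) (Fin N) ℂ) (K j : ℕ) (B : Fin (F.P K).d → Site (F.P K) j → V) (b : PBond (F.P K) j) :
    chartField F N ρ K j B b = suOfMat N (exp (ρ (B b.dir b.src))) := rfl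

variable [NeZero N]

/-- At `B = 0` the chart sits at the unit configuration (`exp 0 = 1`). [cite: Balaban1987RG1, (1.20) p.264 (bookkeeping)] -/
theorem chartField_zero (ρ : V →L[ℝ] Matrix (Fin N) (Fin N) ℂ) (K j : ℕ) : chartField F N ρ K j 0 = 1 := by
  funext b
  rw [chartField_apply, Pi.zero_apply, Pi.zero_apply, map_zero, NormedSpace.exp_zero, suOfMat_one]
  rfl

omit [NeZero N] in
/-- **The chart field is CONTINUOUS AT `B = 0`** (bondwise: `exp ∘ ρ ∘ evaluation` is continuous, `suOfMat` is continuous at its value `1`).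
[cite: Balaban1987RG1, (1.20) p.264 (bookkeeping)] -/
theorem continuousAt_chartField_zero (ρ : V →L[ℝ] Matrix (Fin N) (Fin N) ℂ) (K j : ℕ) : ContinuousAt (chartField F N ρ K j) 0 := by
  show ContinuousAt (fun (B : Fin (F.P K).d → Site (F.P K) j → V) (b : PBond (F.P K) j) => suOfMat N (exp (ρ (B b.dir b.src)))) 0
  rw [continuousAt_pi]
  intro b
  have hcont : Continuous fun B : Fin (F.P K).d → Site (F.P K) j → V => exp (ρ (B b.dir b.src)) := by
    open scoped Matrix.Norms.Operator in
    exact NormedSpace.exp_continuous.comp (ρ.continuous.comp ((continuous_apply b.src).comp (continuous_apply b.dir)))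
  have h0 : exp (ρ ((0 : Fin (F.P K).d → Site (F.P K) j → V) b.dir b.src)) = (1 : Matrix (Fin N) (Fin N) ℂ) := by
    rw [Pi.zero_apply, Pi.zero_apply, map_zero, NormedSpace.exp_zero]
  exact ContinuousAt.comp_of_eq (continuousAt_suOfMat_one N) hcont.continuousAt h0

/-- … so it TENDS TO THE UNIT CONFIGURATION as `B → 0`. [cite: Balaban1987RG1, (1.20) p.264 (bookkeeping)] -/
theorem tendsto_chartField_zero (ρ : V →L[ℝ] Matrix (Fin N) (Fin N) ℂ) (K j : ℕ) : Tendsto (chartField F N ρ K j) (𝓝 0) (𝓝 1) := by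
  have h := continuousAt_chartField_zero F N ρ K j
  rwa [ContinuousAt, chartField_zero] at h

/-- **The merged-term chart IS the merged term at the chart field** (definitional unfolding): `expChart (ℰ_T k hist K) ρ B = 𝓝_{k+1}(extd hist; chartField ρ B)`.
[cite: Balaban1987RG1, (1.6) p.261 and (1.20) p.264 (bookkeeping)] -/
theorem expChart_mergedTermFamilyMatT (T : Transport F N) (χ : (K : ℕ) → (ℕ → ℝ) → (k : ℕ) → Density (F.P K) k (SU N)) (ε : ℝ)
    (ρ : V →L[ℝ] Matrix (Fin N) (Fin N) ℂ) (k : ℕ) (hist : Fin (k + 1) → ℝ) (K : ℕ) (B : Fin (F.P K).d → Site (F.P K) (k + 1) → V) :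
    expChart (mergedTermFamilyMatT F N T χ ε k hist K) ρ B = mergedTermT F N T χ ε K (extd hist) k (chartField F N ρ K (k + 1) B) := by
  unfold mergedTermFamilyMatT mergedTermFamilyT chartField
  rfl

/-- **Near `B = 0` the chart field lies in every small-field domain of record** (`0 < ε₀`: the domain is an open set containing `1` — n09-a's `isOpen_domAltOfRecord`,
K0e's `one_mem_domAltOfRecord`). [cite: Balaban1987RG1, p.259 and (1.2) p.260 (bookkeeping)] -/
theorem eventually_chartField_mem_domAltOfRecord (ν : Stage7Numerics) (hε : 0 < ν.ε₀) (ρ : V →L[ℝ] Matrix (Fin N) (Fin N) ℂ) (K j : ℕ) :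
    ∀ᶠ B in 𝓝 (0 : Fin (F.P K).d → Site (F.P K) j → V), chartField F N ρ K j B ∈ domAltOfRecord F N ν K j :=
  tendsto_chartField_zero F N ρ K j ((isOpen_domAltOfRecord ν K j).mem_nhds (one_mem_domAltOfRecord ν hε K j))

end Chart

/-! ## §3. The comparison of the two β's: level 0 free; all levels under the located nesting hypothesis -/

section Comparison

variable (F : T4Family) (N : ℕ) [NeZero N]

/-- **LOCATED HYPOTHESIS — THE NESTING OF THE SMALL-FIELD DOMAINS UNDER THE BACKGROUND MAP** (displayed, never asserted): at every torus and step `k < K`, for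
every level-`(k+1)` configuration `W` of the record's small-field domain, the `k`-fold average `Ū^k(U_{k+1}(W))` of its background configuration (0.21) lies in
the level-`k` small-field domain — the condition under which (1.6)'s `A_k(Ū^k U_{k+1}(W))` is read ON the domain of `A_k`.  Print: *«this condition implies
|V(∂p′) − 1| < 2ε₀ for p′ ∈ T₁^{(k)} … Proposition 2 [12] … Theorem 1 [15]»* — a regularity ESTIMATE ([Balaban1985Averaging] Prop. 2, [Balaban1985Variational]
Thm 1) at admissible numerics, the shape of n09-a's plug binder `hnest`; a hypothesis wherever used. [cite: Balaban1987RG1, (0.21)–(0.23) p.256, p.259 and (1.1)–(1.2) p.260] -/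
def Stage8Params.AvgBgNest (θ : Stage8Params F N) : Prop :=
  ∀ (K k : ℕ), k < K → ∀ W ∈ domAltOfRecord F N θ.ν K (k + 1),
    Averaging.iter (avOfRecord F N K) k (Uk F N K (k + 1) θ.εbg W) ∈ domAltOfRecord F N θ.ν K k

variable {F N}

/-- Under the nesting hypothesis and `0 < ε₀`, the averaged background of a NEAR-UNIT level-`(k+1)` configuration lies in the level-`k` domain (the domain at level
`k+1` is a neighbourhood of `1`) — the eventual form the comparison consumes. [cite: Balaban1987RG1, (0.23) p.256 and p.259 (bookkeeping)] -/
theorem Stage8Params.AvgBgNest.eventually {θ : Stage8Params F N} (h : θ.AvgBgNest F N) (hε : 0 < θ.ν.ε₀) {K k : ℕ} (hk : k < K) :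
    ∀ᶠ W in 𝓝 (1 : GaugeField (F.P K) (k + 1) (SU N)), Averaging.iter (avOfRecord F N K) k (Uk F N K (k + 1) θ.εbg W) ∈ domAltOfRecord F N θ.ν K k :=
  mem_of_superset ((isOpen_domAltOfRecord θ.ν K (k + 1)).mem_nhds (one_mem_domAltOfRecord θ.ν hε K (k + 1))) fun W hW => h K k hk W hW

/-- **THE FIRST SUMMAND of (1.6) near the base point**: under `0 < ε₀` and the everywhere proviso, `A_{k+1}^{On}(chartField B) = A_{k+1}^{c}(chartField B)` for `B`
near `0`, `k < K` (K0e's `effActionHT_TcOnOfRecord_eqOn` on `domAltOfRecord ν K (k+1)` ∋ the chart field eventually). [cite: Balaban1987RG1, (0.19) p.255, p.259 and (1.6) p.261 (bookkeeping)] -/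
theorem eventually_effActionHT_TcOn_succ_chartField_eq {V : Type*} [NormedAddCommGroup V] [NormedSpace ℝ V] (θ : Stage8Params F N) (hε : 0 < θ.ν.ε₀)
    (hT : θ.HasContTransportAlong) (ρ : V →L[ℝ] Matrix (Fin N) (Fin N) ℂ) {K k : ℕ} (hk : k < K) (g : ℕ → ℝ) :
    ∀ᶠ B in 𝓝 (0 : Fin (F.P K).d → Site (F.P K) (k + 1) → V),
      effActionHT F N (TcOnOfRecord F N θ.ν) (chiFixed7 F N θ.ν) K g (k + 1) (chartField F N ρ K (k + 1) B) =
        effActionHT F N (TcOfRecord F N) (chiFixed7 F N θ.ν) K g (k + 1) (chartField F N ρ K (k + 1) B) :=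
  (eventually_chartField_mem_domAltOfRecord F N θ.ν hε ρ K (k + 1)).mono fun _ hB =>
    effActionHT_TcOnOfRecord_eqOn θ.ν hε K g (fun j hj => hT K g j hj) hk hB

/-- **THE SECOND SUMMAND of (1.6) near the base point, LEVEL 0**: `A_0 = −A/g_0²` reads no transport, so the two `A_0(Ū^0 U_1(chartField B))` agree for every `B`.
[cite: Balaban1987RG1, (0.17) p.255 and (1.6) p.261 (bookkeeping)] -/
theorem effActionHT_TcOn_zero_eq (ν : Stage7Numerics) (χ : (K : ℕ) → (ℕ → ℝ) → (k : ℕ) → Density (F.P K) k (SU N)) (K : ℕ) (g : ℕ → ℝ) :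
    effActionHT F N (TcOnOfRecord F N ν) χ K g 0 = effActionHT F N (TcOfRecord F N) χ K g 0 := by
  rw [effActionHT_zero, effActionHT_zero]

/-- **THE SECOND SUMMAND of (1.6) near the base point, LEVEL `k+1`**: under `0 < ε₀`, the everywhere proviso and the nesting hypothesis (eventual form at this step),
`A_{k+1}^{On}(Ū^{k+1} U_{k+2}(chartField B)) = A_{k+1}^{c}(…)` for `B` near `0`, `k < K`. [cite: Balaban1987RG1, (0.19) p.255, (0.23) p.256 and (1.6) p.261 (bookkeeping)] -/
theorem eventually_effActionHT_TcOn_succ_avgBg_eq {V : Type*} [NormedAddCommGroup V] [NormedSpace ℝ V] (θ : Stage8Params F N) (hε : 0 < θ.ν.ε₀)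
    (hT : θ.HasContTransportAlong) (ρ : V →L[ℝ] Matrix (Fin N) (Fin N) ℂ) {K k : ℕ} (hk : k < K) (g : ℕ → ℝ)
    (hnest : ∀ᶠ W in 𝓝 (1 : GaugeField (F.P K) (k + 1 + 1) (SU N)),
      Averaging.iter (avOfRecord F N K) (k + 1) (Uk F N K (k + 1 + 1) θ.εbg W) ∈ domAltOfRecord F N θ.ν K (k + 1)) :
    ∀ᶠ B in 𝓝 (0 : Fin (F.P K).d → Site (F.P K) (k + 1 + 1) → V),
      effActionHT F N (TcOnOfRecord F N θ.ν) (chiFixed7 F N θ.ν) K g (k + 1)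
          (Averaging.iter (avOfRecord F N K) (k + 1) (Uk F N K (k + 1 + 1) θ.εbg (chartField F N ρ K (k + 1 + 1) B))) =
        effActionHT F N (TcOfRecord F N) (chiFixed7 F N θ.ν) K g (k + 1)
          (Averaging.iter (avOfRecord F N K) (k + 1) (Uk F N K (k + 1 + 1) θ.εbg (chartField F N ρ K (k + 1 + 1) B))) :=
  have hev : ∀ᶠ B in 𝓝 (0 : Fin (F.P K).d → Site (F.P K) (k + 1 + 1) → V),
      Averaging.iter (avOfRecord F N K) (k + 1) (Uk F N K (k + 1 + 1) θ.εbg (chartField F N ρ K (k + 1 + 1) B)) ∈ domAltOfRecord F N θ.ν K (k + 1) :=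
    (tendsto_chartField_zero F N ρ K (k + 1 + 1)).eventually hnest
  hev.mono fun _ hB => effActionHT_TcOnOfRecord_eqOn θ.ν hε K g (fun j hj => hT K g j hj) hk hB

/-- **THE MERGED TERM (1.6) AT LEVEL 0 near the base point**: `𝓝_1^{On}(chartField B) = 𝓝_1^{c}(chartField B)` for `B` near `0`, every torus `K ≥ 1` and history —
NO nesting hypothesis. [cite: Balaban1987RG1, (1.6) p.261 (bookkeeping)] -/
theorem expChart_mergedTermFamilyMatT_TcOn_zero_eventuallyEq {V : Type*} [NormedAddCommGroup V] [NormedSpace ℝ V] (θ : Stage8Params F N)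
    (hε : 0 < θ.ν.ε₀) (hT : θ.HasContTransportAlong) (ρ : V →L[ℝ] Matrix (Fin N) (Fin N) ℂ) {K : ℕ} (hK : 0 < K) (hist : Fin 1 → ℝ) :
    expChart (mergedTermFamilyMatT F N (TcOnOfRecord F N θ.ν) (chiFixed7 F N θ.ν) θ.εbg 0 hist K) ρ =ᶠ[𝓝 0]
      expChart (mergedTermFamilyMatT F N (TcOfRecord F N) (chiFixed7 F N θ.ν) θ.εbg 0 hist K) ρ :=
  (eventually_effActionHT_TcOn_succ_chartField_eq θ hε hT ρ hK (extd hist)).mono fun B hB => by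
    rw [expChart_mergedTermFamilyMatT, expChart_mergedTermFamilyMatT, mergedTermT, mergedTermT, hB, effActionHT_TcOn_zero_eq]

/-- **THE MERGED TERM (1.6) AT LEVEL `k+1` near the base point** under the nesting hypothesis (eventual form at this step): the two charts agree near `0`, `k + 1 < K`.
[cite: Balaban1987RG1, (1.6) p.261 and (0.23) p.256 (bookkeeping)] -/
theorem expChart_mergedTermFamilyMatT_TcOn_succ_eventuallyEq {V : Type*} [NormedAddCommGroup V] [NormedSpace ℝ V] (θ : Stage8Params F N)
    (hε : 0 < θ.ν.ε₀) (hT : θ.HasContTransportAlong) (ρ : V →L[ℝ] Matrix (Fin N) (Fin N) ℂ) {K k : ℕ} (hK : k + 1 < K) (hist : Fin (k + 1 + 1) → ℝ)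
    (hnest : ∀ᶠ W in 𝓝 (1 : GaugeField (F.P K) (k + 1 + 1) (SU N)),
      Averaging.iter (avOfRecord F N K) (k + 1) (Uk F N K (k + 1 + 1) θ.εbg W) ∈ domAltOfRecord F N θ.ν K (k + 1)) :
    expChart (mergedTermFamilyMatT F N (TcOnOfRecord F N θ.ν) (chiFixed7 F N θ.ν) θ.εbg (k + 1) hist K) ρ =ᶠ[𝓝 0]
      expChart (mergedTermFamilyMatT F N (TcOfRecord F N) (chiFixed7 F N θ.ν) θ.εbg (k + 1) hist K) ρ :=
  ((eventually_effActionHT_TcOn_succ_chartField_eq θ hε hT ρ hK (extd hist)).and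
      (eventually_effActionHT_TcOn_succ_avgBg_eq θ hε hT ρ (K := K) (k := k) (Nat.lt_of_succ_lt hK) (extd hist) hnest)).mono fun B hB => by
    rw [expChart_mergedTermFamilyMatT, expChart_mergedTermFamilyMatT, mergedTermT, mergedTermT, hB.1, hB.2]

variable (F N)

/-- **LEVEL 0 IS FREE — `β_1^{On} = β_1^{c}`**: under `0 < ε₀` and the record's everywhere proviso `HasContTransportAlong` (`Provisos₁₀.contT`), the β of record read
through the on-domain transport and through the everywhere transport AGREE AT LEVEL 0 (as functions of the one-term history) — no nesting hypothesis.
[cite: Balaban1987RG1, (1.20)–(1.22) p.264 and (1.6) p.261] -/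
theorem betaOfRecord₈cOn_zero_eq (θ : Stage8Params F N) (hε : 0 < θ.ν.ε₀) (hT : θ.HasContTransportAlong) :
    betaOfRecord₈cOn F N θ 0 = betaOfRecord₈c F N θ 0 := by
  letI := θ.instVβ₁; letI := θ.instVβ₂; letI := θ.instιβ
  have hm : betaMerged F (mergedTermFamilyMatT F N (TcOnOfRecord F N θ.ν) (chiFixed7 F N θ.ν) θ.εbg) θ.ρ8 θ.bV 0 =
      betaMerged F (mergedTermFamilyMatT F N (TcOfRecord F N) (chiFixed7 F N θ.ν) θ.εbg) θ.ρ8 θ.bV 0 :=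
    betaMerged_congr_at F θ.ρ8 θ.bV fun hist =>
      (eventually_gt_atTop 0).mono fun K hK => expChart_mergedTermFamilyMatT_TcOn_zero_eventuallyEq θ hε hT θ.ρ8 hK hist
  exact betaOfMerged_congr_at θ.γ hm (beta0OfMerged_congr_at θ.v₀ hm)

/-- **ALL LEVELS UNDER THE NESTING HYPOTHESIS — `β^{On} = β^{c}`**: under `0 < ε₀`, the everywhere proviso and `AvgBgNest`, the two β's of record COINCIDE (every level,
every history). [cite: Balaban1987RG1, (1.20)–(1.22) p.264, (1.6) p.261 and (0.23) p.256] -/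
theorem betaOfRecord₈cOn_eq_of_avgBgNest (θ : Stage8Params F N) (hε : 0 < θ.ν.ε₀) (hT : θ.HasContTransportAlong) (hnest : θ.AvgBgNest F N) :
    betaOfRecord₈cOn F N θ = betaOfRecord₈c F N θ := by
  letI := θ.instVβ₁; letI := θ.instVβ₂; letI := θ.instιβ
  funext k
  have hm : betaMerged F (mergedTermFamilyMatT F N (TcOnOfRecord F N θ.ν) (chiFixed7 F N θ.ν) θ.εbg) θ.ρ8 θ.bV k =
      betaMerged F (mergedTermFamilyMatT F N (TcOfRecord F N) (chiFixed7 F N θ.ν) θ.εbg) θ.ρ8 θ.bV k := by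
    refine betaMerged_congr_at F θ.ρ8 θ.bV fun hist => (eventually_gt_atTop k).mono fun K hK => ?_
    cases k with
    | zero => exact expChart_mergedTermFamilyMatT_TcOn_zero_eventuallyEq θ hε hT θ.ρ8 hK hist
    | succ k =>
      exact expChart_mergedTermFamilyMatT_TcOn_succ_eventuallyEq θ hε hT θ.ρ8 hK hist
        (hnest.eventually hε (K := K) (k := k + 1) hK)
  exact betaOfMerged_congr_at θ.γ hm (beta0OfMerged_congr_at θ.v₀ hm)

/-- The same over Stage-9 parameters: `betaOfRecord₉cOn θ = betaOfRecord₉c θ` (= `betaOfRecord₁₀ θ`). [cite: Balaban1987RG1, (1.20)–(1.22) p.264 (bookkeeping)] -/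
theorem betaOfRecord₉cOn_eq_of_avgBgNest (θ : Stage9Params F N) (hε : 0 < θ.ν.ε₀) (hT : θ.toStage8Params.HasContTransportAlong)
    (hnest : θ.toStage8Params.AvgBgNest F N) : betaOfRecord₉cOn F N θ = betaOfRecord₉c F N θ :=
  betaOfRecord₈cOn_eq_of_avgBgNest F N θ.toStage8Params hε hT hnest

/-- Level 0 over Stage-9 parameters, no nesting hypothesis. [cite: Balaban1987RG1, (1.20)–(1.22) p.264 (bookkeeping)] -/
theorem betaOfRecord₉cOn_zero_eq (θ : Stage9Params F N) (hε : 0 < θ.ν.ε₀) (hT : θ.toStage8Params.HasContTransportAlong) :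
    betaOfRecord₉cOn F N θ 0 = betaOfRecord₉c F N θ 0 :=
  betaOfRecord₈cOn_zero_eq F N θ.toStage8Params hε hT

/-! ## §4. Consequences for the flows (the (C196) lemma) -/

/-- **FORWARD GENERATION READS `β` BELOW THE STEP**: two β-families agreeing at the levels `< k` generate the same couplings up to step `k` from the same `g_0`
((0.20) solved forward, `FlowStepRuns.genSeq`). [cite: Balaban1987RG1, (0.18)–(0.20) pp.255–256 (bookkeeping)] -/
theorem genSeq_eq_of_forall_lt {β₁ β₂ : HBeta} (g0 : ℝ) : ∀ {k : ℕ}, (∀ j < k, β₁ j = β₂ j) → ∀ i ≤ k, genSeq β₁ g0 i = genSeq β₂ g0 i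
  | 0, _, i, hi => by
    obtain rfl := Nat.le_zero.1 hi
    rw [FlowStepRuns.genSeq_zero, FlowStepRuns.genSeq_zero]
  | k + 1, h, i, hi => by
    rcases Nat.lt_or_eq_of_le hi with hlt | rfl
    · exact genSeq_eq_of_forall_lt g0 (fun j hj => h j (Nat.lt_succ_of_lt hj)) i (Nat.le_of_lt_succ hlt)
    · have ih : ∀ i ≤ k, genSeq β₁ g0 i = genSeq β₂ g0 i :=
        genSeq_eq_of_forall_lt g0 fun j hj => h j (Nat.lt_succ_of_lt hj)
      have hpre : prefixOf (genSeq β₁ g0) k = prefixOf (genSeq β₂ g0) k :=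
        funext fun j => ih j (Nat.le_of_lt_succ j.isLt)
      rw [FlowStepRuns.genSeq_succ, FlowStepRuns.genSeq_succ, ih k le_rfl, hpre, h k (Nat.lt_succ_self k)]

/-- **THE FIRST RENORMALISED COUPLING IS TRANSPORT-INSENSITIVE**: under `0 < ε₀` and `Provisos₁₀.contT`'s everywhere proviso, the runs generated by `betaOfRecord₉cOn θ`
and by `betaOfRecord₉c θ = betaOfRecord₁₀ θ` have the same `g_0, g_1` — no nesting hypothesis. [cite: Balaban1987RG1, (0.20) p.256 and (1.22) p.264 (bookkeeping)] -/
theorem genSeq_betaOfRecord₉cOn_eq_of_le_one (θ : Stage9Params F N) (hε : 0 < θ.ν.ε₀) (hT : θ.toStage8Params.HasContTransportAlong) (g0 : ℝ)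
    {i : ℕ} (hi : i ≤ 1) : genSeq (betaOfRecord₉cOn F N θ) g0 i = genSeq (betaOfRecord₉c F N θ) g0 i :=
  genSeq_eq_of_forall_lt g0 (fun j hj => by obtain rfl := Nat.lt_one_iff.1 hj; exact betaOfRecord₉cOn_zero_eq F N θ hε hT) i hi

/-- **THE (C196) β-COMPARISON LEMMA**: under `0 < ε₀`, the everywhere proviso and the nesting hypothesis, the flow generated by the on-domain β IS the flow
generated by the record's β, run by run: `genFlow (betaOfRecord₉cOn θ) g₀ = genFlow (betaOfRecord₉c θ) g₀`. [cite: Balaban1987RG1, (0.17)–(0.20) pp.255–256 and (1.20)–(1.22) p.264 (bookkeeping)] -/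
theorem genFlow_betaOfRecord₉cOn_eq (θ : Stage9Params F N) (hε : 0 < θ.ν.ε₀) (hT : θ.toStage8Params.HasContTransportAlong)
    (hnest : θ.toStage8Params.AvgBgNest F N) (g0 : ℝ) : genFlow (betaOfRecord₉cOn F N θ) g0 = genFlow (betaOfRecord₉c F N θ) g0 := by
  rw [betaOfRecord₉cOn_eq_of_avgBgNest F N θ hε hT hnest]

/-- … in particular the Stage-10 record's generated history `gOfRecord₁₀ θ p` IS the history the on-domain β generates. [cite: Balaban1987RG1, (0.17)–(0.20) pp.255–256 (bookkeeping)] -/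
theorem gOfRecord₁₀_eq_genSeq_betaOfRecord₉cOn (θ : Stage9Params F N) (hε : 0 < θ.ν.ε₀) (hT : θ.toStage8Params.HasContTransportAlong)
    (hnest : θ.toStage8Params.AvgBgNest F N) (p : B12.RunParams) : gOfRecord₁₀ F N θ p = genSeq (betaOfRecord₉cOn F N θ) p.g0 := by
  rw [betaOfRecord₉cOn_eq_of_avgBgNest F N θ hε hT hnest]

/-- **AT A STAGE-10 RECORD** (`Provisos₁₀.contT` supplies the everywhere proviso): level 0 free, all levels under the nesting hypothesis.
[cite: Balaban1987RG1, (1.20)–(1.22) p.264 (bookkeeping)] -/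
theorem Stage9Params.Provisos₁₀.betaOn_zero_eq {θ : Stage9Params F N} (h : θ.Provisos₁₀) (hε : 0 < θ.ν.ε₀) :
    betaOfRecord₉cOn F N θ 0 = betaOfRecord₉c F N θ 0 :=
  betaOfRecord₉cOn_zero_eq F N θ hε h.contT

/-- … all levels under the nesting hypothesis. [cite: Balaban1987RG1, (1.20)–(1.22) p.264 (bookkeeping)] -/
theorem Stage9Params.Provisos₁₀.betaOn_eq {θ : Stage9Params F N} (h : θ.Provisos₁₀) (hε : 0 < θ.ν.ε₀) (hnest : θ.toStage8Params.AvgBgNest F N) :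
    betaOfRecord₉cOn F N θ = betaOfRecord₉c F N θ :=
  betaOfRecord₉cOn_eq_of_avgBgNest F N θ hε h.contT hnest

/-- … hence the run flows of the Stage-10 datum are those of the on-domain β. [cite: Balaban1987RG1, (0.17)–(0.20) pp.255–256 (bookkeeping)] -/
theorem Stage9Params.Provisos₁₀.flow_eq_genFlow_betaOn {θ : Stage9Params F N} (h : θ.Provisos₁₀) (hε : 0 < θ.ν.ε₀)
    (hnest : θ.toStage8Params.AvgBgNest F N) (p : B12.RunParams) :
    ((datumOfRecord₁₀ F N θ h).C p).flow = genFlow (betaOfRecord₉cOn F N θ) p.g0 := by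
  rw [flow_datumOfRecord₁₀, betaOfRecord₉cOn_eq_of_avgBgNest F N θ hε h.contT hnest]

end Comparison

end Literature.MathematicalPhysics.QuantumFieldTheory.Balaban1983to89.Node00
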